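import Summits.ValiantsHypothesis.ValiantsHypothesis.Theses.LacunarySymmetroid
import Summits.ValiantsHypothesis.ValiantsHypothesis.Theorems.LacunarySymmetroidMatrixDescartesCensusDefs
import Summits.ValiantsHypothesis.ValiantsHypothesis.Theorems.LacunarySymmetroidMatrixDescartesStubArith4

/-!
# `MatrixDescartes` — bridge: the cell's Conjecture B (`K + log² m` law) implies the crux

HONEST FRAMING.  Object-search cell `pub-symmetroid`.  This file proves ONE implication between two statements
that are both OPEN: `KPlusLogSqLaw → MatrixDescartes`, where `KPlusLogSqLaw` (Defs module) is the theory seat's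
CONJECTURE B (`HOME/CONJECTURE.md` §3: `log₂ ζ_tot(m,K) ≤ C·(K + log₂² m)` for an absolute `C`) and
`MatrixDescartes` is the crux `stmt-ValiantsHypothesis-18050` as printed.  It therefore proves NOTHING
unconditionally about the crux and claims nothing about `VP ≠ VNP`; it records in the kernel the theory seat's
"B ⇒ MDR [PROVED, one line]": in the crux's regime `m ≤ 2^((⌊log₂K⌋+c)^c)` one has `⌊log₂ m⌋ ≤ (⌊log₂K⌋+c)^c`,
so the law bounds `Z` by `2^(C(K + (⌊log₂K⌋+2c)^(2c)))`, and `q·C·(K + polylog K) ≤ K⌊log₂K⌋` for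
`K ≥ max K₁ 2^(2qC)` (tree `StubArith4.exp_le` for the polylog term, `⌊log₂K⌋ ≥ 2qC` for the linear term).
The converse is not claimed (the law is stronger than the crux outside the quasi-polynomial regime).
-/

-- `Summit.ValiantsHypothesis.ValiantsHypothesis.…` repeats a component by the D-0017 layout
-- (single-conjunct summit), which the `dupNamespace` linter flags; the name is mandated.
set_option linter.dupNamespace false

namespace Summit.ValiantsHypothesis.ValiantsHypothesis.Theorems.LacunarySymmetroidMatrixDescartes.Census

open Summit.ValiantsHypothesis.ValiantsHypothesis.Theses.LacunarySymmetroid (MatrixDescartes)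
open scoped BigOperators

/-- **Conjecture B implies the crux**: `KPlusLogSqLaw → MatrixDescartes` — the cell's «`K + log² m` law»
(theory seat, `HOME/CONJECTURE.md` §3, typed in the Defs module) implies `stmt-ValiantsHypothesis-18050` as printed.
Both sides are open; only the implication is proved. [folklore] -/
theorem matrixDescartes_of_kPlusLogSqLaw (h : KPlusLogSqLaw) : MatrixDescartes := by
  obtain ⟨C, hC⟩ := h
  intro c q _hq
  obtain ⟨K₁, hK₁⟩ := StubArith4.exp_le (2 * c) (2 * q * C)
  refine ⟨max K₁ (2 ^ (2 * q * C)), fun K m hK hm d S hS => ?_⟩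
  have hK1 : K₁ ≤ K := le_of_max_le_left hK
  have hK2 : 2 ^ (2 * q * C) ≤ K := le_of_max_le_right hK
  have hL : 2 * q * C ≤ Nat.log 2 K := Nat.le_log_of_pow_le one_lt_two hK2
  have hlogm : Nat.log 2 m ≤ (Nat.log 2 K + c) ^ c :=
    calc Nat.log 2 m ≤ Nat.log 2 (2 ^ ((Nat.log 2 K + c) ^ c)) := Nat.log_mono_right hm
      _ = (Nat.log 2 K + c) ^ c := Nat.log_pow one_lt_two _
  have hsq : Nat.log 2 m ^ 2 ≤ (Nat.log 2 K + 2 * c) ^ (2 * c) :=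
    calc Nat.log 2 m ^ 2 ≤ ((Nat.log 2 K + c) ^ c) ^ 2 := Nat.pow_le_pow_left hlogm 2
      _ = (Nat.log 2 K + c) ^ (2 * c) := by rw [← pow_mul, mul_comm]
      _ ≤ (Nat.log 2 K + 2 * c) ^ (2 * c) := Nat.pow_le_pow_left (by omega) _
  have hZ := hC m K d S hS
  have h1 : 2 * q * C * (Nat.log 2 K + 2 * c) ^ (2 * c) ≤ K * Nat.log 2 K := hK₁ K hK1
  have h2 : 2 * q * C * K ≤ K * Nat.log 2 K :=
    calc 2 * q * C * K = K * (2 * q * C) := by ring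
      _ ≤ K * Nat.log 2 K := Nat.mul_le_mul_left K hL
  have h3 : q * C * Nat.log 2 m ^ 2 ≤ q * C * (Nat.log 2 K + 2 * c) ^ (2 * c) :=
    Nat.mul_le_mul_left _ hsq
  have hexp : q * (C * (K + Nat.log 2 m ^ 2)) ≤ K * Nat.log 2 K := by
    have e1 : q * (C * (K + Nat.log 2 m ^ 2)) = q * C * K + q * C * Nat.log 2 m ^ 2 := by ring
    have e2 : 2 * q * C * (Nat.log 2 K + 2 * c) ^ (2 * c) = 2 * (q * C * (Nat.log 2 K + 2 * c) ^ (2 * c)) := by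
      ring
    have e3 : 2 * q * C * K = 2 * (q * C * K) := by ring
    rw [e2] at h1
    rw [e3] at h2
    omega
  calc (Matrix.det (∑ l, ((Polynomial.X : Polynomial ℝ) ^ d l) • (S l).map Polynomial.C)
          ).roots.toFinset.card ^ q
      ≤ (2 ^ (C * (K + Nat.log 2 m ^ 2))) ^ q := Nat.pow_le_pow_left hZ q
    _ = 2 ^ (q * (C * (K + Nat.log 2 m ^ 2))) := by rw [← pow_mul, mul_comm]
    _ ≤ 2 ^ (K * Nat.log 2 K) := Nat.pow_le_pow_right (by norm_num) hexp

end Summit.ValiantsHypothesis.ValiantsHypothesis.Theorems.LacunarySymmetroidMatrixDescartes.Census
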